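import Summits.NavierStokesRegularity.NavierStokesRegularity.Theses.TypeICertificateLadder
import Summits.NavierStokesRegularity.NavierStokesRegularity.Theorems.RungReynoldsOne.Negative.WithoutLerayHopfFalse

/-!
# `TypeIConcentration` (stmt-NavierStokesRegularity-2881): the subcritical upgrade needs finite energy

Negative (support) lemma for the crux `TypeICertificateLadder.TypeIConcentration`, companion of
`Negative/LoadBearing.lean` (cdisprove seat, generation 3; independent imports): the core of the load-bearing stub
`stub_quietDecayUpgrade` (S3) of the ACTIVE crux line `Lines/quiet-point-subcritical-upgrade.lean` —
"a `(c, ρ)`-quiet similarity ball under the Type-I(`C`) envelope stays subcritical,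
`‖u(s,y)‖ ≤ 4c√ν (T−t)^{-3/8} (T−s)^{-1/8}` on the unit ball" — is FALSE once the clause
`IsLerayHopfOn T ν 0 (u 0) u` is removed (its hypotheses S1, S2 are closed statements and are dropped
too): the Type-I drift of `RungReynoldsOne/Negative/WithoutLerayHopfFalse.lean` nucleates out of the
quiet datum `0`. So S3, like PROP M (`calmCoresPersist_core_false_without_LerayHopf`), must spend the
finite-energy structure — in the line, the Oseen/mild representation S1. [folklore]
-/

noncomputable section

set_option linter.dupNamespace false

namespace Summit.NavierStokesRegularity.NavierStokesRegularity.Theorems.TypeIConcentration.Negative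

open Set Filter Topology MeasureTheory Metric Function
open Literature.Analysis.FluidPDE
open Summit.NavierStokesRegularity.NavierStokesRegularity.Theorems.RungReynoldsOneNegative

/-- **The subcritical upgrade is false without Leray–Hopf.** The core of the registered stub
`stub_quietDecayUpgrade` (line `quiet-point-subcritical-upgrade`, the ACTIVE skeleton of the crux;
its hypotheses S1, S2 — closed statements — and the clause `IsLerayHopfOn T ν 0 (u 0) u` removed) is
FALSE: for the Type-I drift (`c_drift = C = 1`, `ν = T = 1`, `t = 0`, quiet datum `0`, envelope
`1 − √(1−s) ≤ 1`) at `s = 1 − δ⁸` one has `‖u(s,0)‖ = δ⁻⁴ − 1`, while the claimed subcritical ceiling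
is `4c · 1^{−3/8} · (δ⁸)^{−1/8} = 4c δ⁻¹`; with `δ = min(1/2, 1/(8c+1))`, `δ⁻⁴(1 − 4cδ³) ≥ 16·7/8 > 1`.
So the `(T−s)^{−1/8}` upgrade, like PROP M, is bought with the mild representation. [folklore] -/
theorem quietDecayUpgrade_core_false_without_LerayHopf :
    ¬ (∀ C : ℝ, 0 < C → ∃ c : ℝ, 0 < c ∧ ∃ ρ : ℝ, 1 < ρ ∧
      ∀ (ν T t : ℝ), 0 < ν → 0 ≤ t → t < T →
      ∀ (u : ℝ → EuclideanSpace ℝ (Fin 3) → EuclideanSpace ℝ (Fin 3))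
        (p : ℝ → EuclideanSpace ℝ (Fin 3) → ℝ),
        IsClassicalNSSolutionOn (Set.Ico 0 T) ν 0 u p → HasRapidSpatialDecay (u 0) →
        (∀ s ∈ Set.Ico t T, ∀ x : EuclideanSpace ℝ (Fin 3),
            Real.sqrt (T - s) * ‖u s x‖ ≤ C * Real.sqrt ν) →
        ∀ x₀ : EuclideanSpace ℝ (Fin 3),
          (∀ y ∈ Metric.closedBall x₀ (ρ * Real.sqrt (ν * (T - t))),
              Real.sqrt (T - t) * ‖u t y‖ ≤ c * Real.sqrt ν) →
          ∀ s ∈ Set.Ico t T, ∀ y ∈ Metric.closedBall x₀ (Real.sqrt (ν * (T - t))),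
            ‖u s y‖ ≤ 4 * c * Real.sqrt ν * (T - t) ^ (-(3 / 8 : ℝ)) * (T - s) ^ (-(1 / 8 : ℝ))) := by
  intro h
  obtain ⟨c, hc, ρ, -, h⟩ := h 1 one_pos
  set δ : ℝ := min (1 / 2) (1 / (8 * c + 1)) with hδ
  have hδ0 : 0 < δ := lt_min (by norm_num) (by positivity)
  have hδne : δ ≠ 0 := hδ0.ne'
  have hδ2 : δ ≤ 1 / 2 := min_le_left _ _
  have hδc : δ ≤ 1 / (8 * c + 1) := min_le_right _ _
  have hδ1 : δ < 1 := by linarith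
  have hδ8 : 0 < δ ^ 8 := by positivity
  have hδ8' : δ ^ 8 ≤ 1 := pow_le_one₀ hδ0.le hδ1.le
  set s : ℝ := 1 - δ ^ 8 with hs
  have hsI : s ∈ Set.Ico (0 : ℝ) 1 := ⟨by rw [hs]; linarith, by rw [hs]; linarith⟩
  have h1s : 1 - s = δ ^ 8 := by rw [hs]; ring
  have henv : ∀ s ∈ Set.Ico (0 : ℝ) 1, ∀ x : EuclideanSpace ℝ (Fin 3),
      Real.sqrt (1 - s) * ‖drift (gI 1) s x‖ ≤ 1 * Real.sqrt 1 := by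
    intro s hs x
    have hg : 0 ≤ gI 1 s := gI_nonneg 1 zero_le_one hs.1 hs.2
    have hs1 := sqrt_one_sub_le_one hs.1
    have hs0 : 0 ≤ Real.sqrt (1 - s) := Real.sqrt_nonneg _
    rw [norm_drift, abs_of_nonneg hg, Real.sqrt_one, sqrt_mul_gI 1 hs.2]
    nlinarith
  have hquiet : ∀ y ∈ Metric.closedBall (0 : EuclideanSpace ℝ (Fin 3)) (ρ * Real.sqrt (1 * (1 - 0))),
      Real.sqrt (1 - 0) * ‖drift (gI 1) 0 y‖ ≤ c * Real.sqrt 1 := by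
    intro y _
    rw [drift_zero (gI_zero 1)]
    simp [hc.le]
  have hy : (0 : EuclideanSpace ℝ (Fin 3)) ∈
      Metric.closedBall (0 : EuclideanSpace ℝ (Fin 3)) (Real.sqrt (1 * (1 - 0))) :=
    Metric.mem_closedBall_self (Real.sqrt_nonneg _)
  have hmain := h 1 1 0 one_pos le_rfl one_pos (drift (gI 1)) (driftP (gI 1))
    (drift_isClassical (gI_contDiffOn 1) 1) (drift_rapidDecay (gI_zero 1)) henv 0 hquiet s hsI 0 hy
  have hnn : 0 ≤ gI 1 s := gI_nonneg 1 zero_le_one hsI.1 hsI.2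
  have hsq : Real.sqrt (δ ^ 8) = δ ^ 4 := by
    rw [show δ ^ 8 = (δ ^ 4) ^ 2 by ring, Real.sqrt_sq (by positivity)]
  have hlhs : ‖drift (gI 1) s (0 : EuclideanSpace ℝ (Fin 3))‖ = (δ ^ 4)⁻¹ - 1 := by
    rw [norm_drift, abs_of_nonneg hnn]
    simp only [gI, h1s, hsq, one_mul]
  have hrpow : (δ ^ 8) ^ (-(1 / 8 : ℝ)) = δ⁻¹ := by
    rw [← Real.rpow_natCast δ 8, ← Real.rpow_mul hδ0.le,
      show ((8 : ℕ) : ℝ) * (-(1 / 8 : ℝ)) = -1 by norm_num, Real.rpow_neg_one]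
  rw [hlhs, sub_zero, Real.one_rpow, h1s, hrpow, Real.sqrt_one] at hmain
  have hδ4 : 0 < δ ^ 4 := by positivity
  have hδ4le : δ ^ 4 ≤ 1 / 16 := by
    calc δ ^ 4 ≤ (1 / 2) ^ 4 := pow_le_pow_left₀ hδ0.le hδ2 4
      _ = 1 / 16 := by norm_num
  have hcδ : 4 * c * δ ^ 3 ≤ 1 / 8 := by
    have h1 : δ ^ 3 ≤ δ * (1 / 2) ^ 2 := by
      have : δ ^ 3 = δ * δ ^ 2 := by ring
      rw [this]; exact mul_le_mul_of_nonneg_left (pow_le_pow_left₀ hδ0.le hδ2 2) hδ0.le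
    have h2 : c * δ ≤ c * (1 / (8 * c + 1)) := mul_le_mul_of_nonneg_left hδc hc.le
    have h3 : c * (1 / (8 * c + 1)) ≤ 1 / 8 := by
      rw [mul_one_div, div_le_div_iff₀ (by positivity) (by norm_num)]
      nlinarith
    nlinarith
  have e1 : ((δ ^ 4)⁻¹ - 1) * δ ^ 4 = 1 - δ ^ 4 := by
    rw [sub_mul, inv_mul_cancel₀ hδ4.ne', one_mul]
  have e3 : δ⁻¹ * δ ^ 4 = δ ^ 3 := by
    rw [pow_succ' δ 3, ← mul_assoc, inv_mul_cancel₀ hδne, one_mul]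
  have e2 : 4 * c * 1 * 1 * δ⁻¹ * δ ^ 4 = 4 * c * δ ^ 3 := by
    calc 4 * c * 1 * 1 * δ⁻¹ * δ ^ 4 = 4 * c * (δ⁻¹ * δ ^ 4) := by ring
      _ = 4 * c * δ ^ 3 := by rw [e3]
  have key := mul_le_mul_of_nonneg_right hmain hδ4.le
  rw [e1, e2] at key
  linarith

end Summit.NavierStokesRegularity.NavierStokesRegularity.Theorems.TypeIConcentration.Negative

end
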